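import Summits.QuantumAdvantage.QuantumAdvantage.Theorems.CubicForrelationNearExactIsExactTwelveLevelSixOffFlat216A

/-!
# Crux `CubicForrelation.NearExactIsExact` (stmt-QuantumAdvantage-14043) — n = 12, level ≥ 6: the residual off the 9-flat at off-flat energy
  `≤ 216` (for the rung `933/1024`: budget `Σ e² = 728`)

Certificate seat `b2b-cforr-cert` (gen 18).  HONEST FRAMING: a lemma (standard axioms) for the level-`≥ 6` branch of "is `933/1024` attained at
`n = 12`?"; finite-slice bookkeeping, NOT summit progress.  `tw18_off_flat_le208` (gen 18, rung `934`) with `8` more units of energy: the round-1 case is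
`tw18_off_flat_bad1_216` (part A), the round-2 case is gen 15/16's verbatim.

`tw18_off_flat_le216`: cubic `f, g`, `W_g = 64u''`, `Z = {u'' even} = x_Z ⊕ V₀` 9-flat, `e = u'' − (−1)^f` with `Σ_{x ∉ Z} e² ≤ 216`.  Then
EITHER `8 ∣ e` off `Z`; OR the off-flat energy is `≥ 128` and the points with `8 ∤ e` lie in two distinct cosets `y₁ ⊕ V₀`, `y₂ ⊕ V₀` (`≠ Z`),
at most `31` in each; OR (RIGID) the off-flat energy is `≥ 192` and `Ω = {y ∉ Z : 8 ∤ e(y)}` has at most `54` points, all but at most two with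
`e² = 4`, inside three pairwise distinct cosets `≠ Z`.

References: J. Ax (1964) / R. J. McEliece (1972); MacWilliams–Sloane (1977) Ch. 13 §3.  Axioms: the standard three.
-/



set_option linter.dupNamespace false -- D-0017: single-problem summit ⇒ `QuantumAdvantage.QuantumAdvantage` by design

noncomputable section

namespace Summit.QuantumAdvantage.QuantumAdvantage.Theorems.CubicForrelation.NearExactIsExact

open Finset
open Literature.Computability.QuantumComplexity
open Literature.Computability.QuantumComplexity.BuzetChailloux (bxor zeroVec bxor_bxor_cancel_left bxor_zeroVec zeroVec_bxor bxor_comm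
  bxor_self)
open Literature.Computability.QuantumComplexity.DerivativeWalsh (W)

/-! ### The residual off the 9-flat, energy `≤ 216` -/

/-- **Off the flat at energy `≤ 216`: `8 ∣ e`, or a sparse two-coset exception, or a RIGID exception (two exceptional points allowed).**  See the
module docstring. [this work] -/
theorem tw18_off_flat_le216 (f g : (Fin (6 + 6) → Bool) → Bool) (hf : IsDegLeFun 3 f) (hg : IsDegLeFun 3 g)
    (u'' : (Fin (6 + 6) → Bool) → ℤ) (hu'' : ∀ x, W (fun y => signOf (g y)) x = (2 : ℝ) ^ 6 * (u'' x : ℝ))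
    (V₀ : Finset (Fin (6 + 6) → Bool)) (xZ : Fin (6 + 6) → Bool) (h0 : zeroVec ∈ V₀)
    (hadd : ∀ a ∈ V₀, ∀ b ∈ V₀, bxor a b ∈ V₀) (hcardV9 : #V₀ = 2 ^ 9)
    (hS : (univ.filter fun x : Fin (6 + 6) → Bool => ¬ Odd (u'' x)) = V₀.image (bxor xZ))
    (hoff_le : ∑ x ∈ univ.filter (fun x => x ∉ (univ.filter fun x : Fin (6 + 6) → Bool => ¬ Odd (u'' x))),
      (u'' x - sZ (f x)) ^ 2 ≤ 216) :
    (∀ y, y ∉ (univ.filter fun x : Fin (6 + 6) → Bool => ¬ Odd (u'' x)) → (8 : ℤ) ∣ u'' y - sZ (f y)) ∨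
    (∃ y₁ y₂ : Fin (6 + 6) → Bool, y₁ ∉ (univ.filter fun x : Fin (6 + 6) → Bool => ¬ Odd (u'' x)) ∧
      y₂ ∉ (univ.filter fun x : Fin (6 + 6) → Bool => ¬ Odd (u'' x)) ∧ y₂ ∉ V₀.image (bxor y₁) ∧
      (∀ y, y ∉ (univ.filter fun x : Fin (6 + 6) → Bool => ¬ Odd (u'' x)) → y ∉ V₀.image (bxor y₁) → y ∉ V₀.image (bxor y₂) →
        (8 : ℤ) ∣ u'' y - sZ (f y)) ∧
      #((V₀.image (bxor y₁)).filter fun y => ¬ (8 : ℤ) ∣ u'' y - sZ (f y)) ≤ 31 ∧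
      #((V₀.image (bxor y₂)).filter fun y => ¬ (8 : ℤ) ∣ u'' y - sZ (f y)) ≤ 31 ∧
      128 ≤ ∑ x ∈ univ.filter (fun x => x ∉ (univ.filter fun x : Fin (6 + 6) → Bool => ¬ Odd (u'' x))), (u'' x - sZ (f x)) ^ 2) ∨
    (∃ y₁ y₂ y₃ : Fin (6 + 6) → Bool, y₁ ∉ (univ.filter fun x : Fin (6 + 6) → Bool => ¬ Odd (u'' x)) ∧
      y₂ ∉ (univ.filter fun x : Fin (6 + 6) → Bool => ¬ Odd (u'' x)) ∧ y₃ ∉ (univ.filter fun x : Fin (6 + 6) → Bool => ¬ Odd (u'' x)) ∧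
      y₂ ∉ V₀.image (bxor y₁) ∧ y₃ ∉ V₀.image (bxor y₁) ∧ y₃ ∉ V₀.image (bxor y₂) ∧
      (∀ ω ∈ univ.filter (fun ω => ω ∉ (univ.filter fun x : Fin (6 + 6) → Bool => ¬ Odd (u'' x)) ∧ ¬ (8 : ℤ) ∣ u'' ω - sZ (f ω)),
        ω ∈ V₀.image (bxor y₁) ∨ ω ∈ V₀.image (bxor y₂) ∨ ω ∈ V₀.image (bxor y₃)) ∧
      #(univ.filter (fun ω => ω ∉ (univ.filter fun x : Fin (6 + 6) → Bool => ¬ Odd (u'' x)) ∧ ¬ (8 : ℤ) ∣ u'' ω - sZ (f ω))) ≤ 54 ∧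
      (∃ ω₄ ω₄' : Fin (6 + 6) → Bool, ∀ ω ∈ univ.filter (fun ω => ω ∉ (univ.filter fun x : Fin (6 + 6) → Bool => ¬ Odd (u'' x)) ∧
        ¬ (8 : ℤ) ∣ u'' ω - sZ (f ω)), (u'' ω - sZ (f ω)) ^ 2 = 4 ∨ ω = ω₄ ∨ ω = ω₄') ∧
      192 ≤ ∑ x ∈ univ.filter (fun x => x ∉ (univ.filter fun x : Fin (6 + 6) → Bool => ¬ Odd (u'' x))), (u'' x - sZ (f x)) ^ 2) := by
  classical
  set Z := univ.filter (fun x : Fin (6 + 6) → Bool => ¬ Odd (u'' x)) with hZdef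
  have hmemZ : ∀ x, x ∈ Z ↔ ¬ Odd (u'' x) := fun x => by simp [hZdef]
  set e : (Fin (6 + 6) → Bool) → ℤ := fun x => u'' x - sZ (f x) with hedef
  show (∀ y, y ∉ Z → (8 : ℤ) ∣ e y) ∨ (∃ y₁ y₂ : Fin (6 + 6) → Bool, y₁ ∉ Z ∧ y₂ ∉ Z ∧ y₂ ∉ V₀.image (bxor y₁) ∧
      (∀ y, y ∉ Z → y ∉ V₀.image (bxor y₁) → y ∉ V₀.image (bxor y₂) → (8 : ℤ) ∣ e y) ∧
      #((V₀.image (bxor y₁)).filter fun y => ¬ (8 : ℤ) ∣ e y) ≤ 31 ∧ #((V₀.image (bxor y₂)).filter fun y => ¬ (8 : ℤ) ∣ e y) ≤ 31 ∧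
      128 ≤ ∑ x ∈ univ.filter (fun x => x ∉ Z), e x ^ 2) ∨
    (∃ y₁ y₂ y₃ : Fin (6 + 6) → Bool, y₁ ∉ Z ∧ y₂ ∉ Z ∧ y₃ ∉ Z ∧
      y₂ ∉ V₀.image (bxor y₁) ∧ y₃ ∉ V₀.image (bxor y₁) ∧ y₃ ∉ V₀.image (bxor y₂) ∧
      (∀ ω ∈ univ.filter (fun ω => ω ∉ Z ∧ ¬ (8 : ℤ) ∣ e ω), ω ∈ V₀.image (bxor y₁) ∨ ω ∈ V₀.image (bxor y₂) ∨ ω ∈ V₀.image (bxor y₃)) ∧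
      #(univ.filter (fun ω => ω ∉ Z ∧ ¬ (8 : ℤ) ∣ e ω)) ≤ 54 ∧
      (∃ ω₄ ω₄' : Fin (6 + 6) → Bool, ∀ ω ∈ univ.filter (fun ω => ω ∉ Z ∧ ¬ (8 : ℤ) ∣ e ω), e ω ^ 2 = 4 ∨ ω = ω₄ ∨ ω = ω₄') ∧
      192 ≤ ∑ x ∈ univ.filter (fun x => x ∉ Z), e x ^ 2)
  have heeven : ∀ x, x ∉ Z → Even (e x) := by
    intro x hx
    have hodd : Odd (u'' x) := not_not.1 fun h => hx ((hmemZ x).2 h)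
    rcases tp_sZ_cases (f x) with hs | hs <;> simp only [e] <;> rw [hs] <;>
      exact Int.even_sub.2 (iff_of_false (Int.not_even_iff_odd.2 hodd) (by decide))
  have hPV' : ∀ x, x ∉ Z → ∀ a ∈ V₀, bxor x a ∉ Z := fun x hx a ha => fl1_coset_out' hadd hS hx ha
  -- flat sums of `e`: `4 ∣` on 6-flats, `8 ∣` on 7-flats
  have hflat6 : ∀ (b : Fin (6 + 6) → Bool) (a : Fin 6 → Fin (6 + 6) → Bool),
      (4 : ℤ) ∣ ∑ ε : Fin 6 → Bool, e (fun j => b j ^^ decide (Odd #(univ.filter fun i => ε i && a i j))) :=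
    fun b a => tw15_e_flat6 f g hf hg u'' hu'' b a
  have hflat7 : ∀ (b : Fin (6 + 6) → Bool) (a : Fin 7 → Fin (6 + 6) → Bool),
      (8 : ℤ) ∣ ∑ ε : Fin 7 → Bool, e (fun j => b j ^^ decide (Odd #(univ.filter fun i => ε i && a i j))) :=
    fun b a => tw15_e_flat7 f g hf hg u'' hu'' b a
  -- OFF-Z KILL, round 1: `4 ∣ e` off `Z`
  have hcos_out : ∀ p, p ∉ Z → ∀ b ∈ V₀.image (bxor p), b ∉ Z := by
    intro p hp b hb
    obtain ⟨v, hv, rfl⟩ := mem_image.1 hb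
    exact hPV' p hp v hv
  have hoff_count : ∀ (T : Finset (Fin (6 + 6) → Bool)) (c : ℤ), (∀ x ∈ T, x ∉ Z) → (∀ x ∈ T, c ≤ e x ^ 2) →
      c * #T ≤ 216 := by
    intro T c hT hc
    calc c * #T = ∑ x ∈ T, c := by rw [sum_const, nsmul_eq_mul, mul_comm]
      _ ≤ ∑ x ∈ T, e x ^ 2 := sum_le_sum hc
      _ ≤ ∑ x ∈ univ.filter (fun x => x ∉ Z), e x ^ 2 :=
          sum_le_sum_of_subset_of_nonneg (fun x hx => mem_filter.2 ⟨mem_univ _, hT x hx⟩) fun x _ _ => sq_nonneg _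
      _ ≤ 216 := hoff_le
  have hxZ : xZ ∈ Z := by rw [hS]; exact mem_image.2 ⟨zeroVec, h0, bxor_zeroVec xZ⟩
  have hPV : ∀ x, x ∈ Z → ∀ a ∈ V₀, bxor x a ∈ Z := fun x hx a ha => fl1_coset_vadd hadd hS hx ha
  have hp2 : ∀ y, y ∉ Z → e y = 2 * (e y / 2) := fun y hy =>
    (Int.mul_ediv_cancel' (even_iff_two_dvd.1 (heeven y hy))).symm
  have hcost4 : ∀ x, x ∉ Z → Odd (e x / 2) → 4 ≤ e x ^ 2 := by
    intro x hx hodd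
    have h0' := Int.odd_iff.1 hodd
    have h2 := hp2 x hx
    have : e x ≤ -2 ∨ 2 ≤ e x := by omega
    have := tp_sq_ge (k := 2) (by norm_num) this
    linarith
  -- round 1a: in a coset `p ⊕ V₀` (`p ∉ Z`) `e/2` is even, or odd at `≥ 16` points (6-flat parity + Reed–Muller on the abstract flat)
  have hdich : ∀ p, p ∉ Z → (∀ x ∈ V₀.image (bxor p), Even (e x / 2)) ∨
      16 ≤ #((V₀.image (bxor p)).filter fun x => Odd (e x / 2)) := by
    intro p hp
    rcases ws_erm_round V₀ h0 hadd hcardV9 p (fun y => e y / 2) 5 (fun b hb a ha => by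
        have hpts : ∀ ε : Fin (5 + 1) → Bool, (fun j => b j ^^ decide (Odd #(univ.filter fun i => ε i && a i j))) ∉ Z :=
          fun ε => ws_flatPt_mem V₀ h0 (· ∉ Z) hPV' (5 + 1) b (hcos_out p hp b hb) a ha ε
        have h4 := hflat6 b a
        rw [sum_congr rfl fun ε _ => hp2 _ (hpts ε), ← mul_sum] at h4
        obtain ⟨k, hk⟩ := h4
        exact ⟨k, by linarith⟩) with hev | hbig
    · exact Or.inl hev
    · right; norm_num at hbig; omega
  have hbad_of_odd : ∀ p, p ∉ Z → Odd (e p / 2) → 16 ≤ #((V₀.image (bxor p)).filter fun x => Odd (e x / 2)) := by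
    intro p hp hpodd
    refine (hdich p hp).resolve_left fun h => ?_
    exact (Int.not_even_iff_odd.2 hpodd) (h p (mem_image.2 ⟨zeroVec, h0, bxor_zeroVec p⟩))
  -- a nonzero even value costs `≥ 4`
  have hcost4' : ∀ x, x ∉ Z → e x ≠ 0 → 4 ≤ e x ^ 2 := by
    intro x hx hne
    obtain ⟨k, hk⟩ := heeven x hx
    have hk0 : k ≠ 0 := by rintro rfl; exact hne (by rw [hk]; ring)
    have : e x ≤ -2 ∨ 2 ≤ e x := by omega
    have := tp_sq_ge (k := 2) (by norm_num) this
    linarith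
  have hsymm : ∀ q x : Fin (6 + 6) → Bool, x ∈ V₀.image (bxor q) → q ∈ V₀.image (bxor x) := by
    intro q x hx
    obtain ⟨v, hv, hvx⟩ := mem_image.1 hx
    exact mem_image.2 ⟨v, hv, by rw [← hvx, iw_bxor_assoc, bxor_self, bxor_zeroVec]⟩
  have hchain : ∀ q x w : Fin (6 + 6) → Bool, x ∈ V₀.image (bxor q) → w ∈ V₀.image (bxor x) → w ∈ V₀.image (bxor q) := by
    intro q x w hx hw
    obtain ⟨v, hv, hvx⟩ := mem_image.1 hx
    obtain ⟨v', hv', hv'w⟩ := mem_image.1 hw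
    exact mem_image.2 ⟨bxor v v', hadd v hv v' hv', by rw [← hv'w, ← hvx, iw_bxor_assoc]⟩
  -- round 2 dichotomy ON A COSET where `4 ∣ e`: `e/4` is even there, or odd at `≥ 8` points (7-flat parity + Reed–Muller)
  have hcost16 : ∀ x, x ∉ Z → (4 : ℤ) ∣ e x → Odd (e x / 4) → 16 ≤ e x ^ 2 := by
    intro x _ h4 hodd
    have h0' := Int.odd_iff.1 hodd
    have h2 := (Int.mul_ediv_cancel' h4).symm
    have : e x ≤ -4 ∨ 4 ≤ e x := by omega
    have := tp_sq_ge (k := 4) (by norm_num) this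
    linarith
  have hdich4q : ∀ q, q ∉ Z → (∀ x ∈ V₀.image (bxor q), (4 : ℤ) ∣ e x) →
      (∀ x ∈ V₀.image (bxor q), Even (e x / 4)) ∨ 8 ≤ #((V₀.image (bxor q)).filter fun x => Odd (e x / 4)) := by
    intro q hq h4
    have hPVq : ∀ x, x ∈ V₀.image (bxor q) → ∀ a ∈ V₀, bxor x a ∈ V₀.image (bxor q) :=
      fun x hx a ha => fl1_coset_vadd hadd rfl hx ha
    rcases ws_erm_round V₀ h0 hadd hcardV9 q (fun y => e y / 4) 6 (fun b hb a ha => by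
        have hpts : ∀ ε : Fin (6 + 1) → Bool, (fun j => b j ^^ decide (Odd #(univ.filter fun i => ε i && a i j))) ∈ V₀.image (bxor q) :=
          fun ε => ws_flatPt_mem V₀ h0 (· ∈ V₀.image (bxor q)) hPVq (6 + 1) b hb a ha ε
        have h8 := hflat7 b a
        rw [sum_congr rfl fun ε _ => (Int.mul_ediv_cancel' (h4 _ (hpts ε))).symm, ← mul_sum] at h8
        obtain ⟨k, hk⟩ := h8
        exact ⟨k, by linarith⟩) with hev | hbig
    · exact Or.inl hev
    · right; norm_num at hbig; omega
  by_cases hBad : ∃ p, p ∉ Z ∧ Odd (e p / 2)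
  · obtain ⟨p, hp, hpodd⟩ := hBad
    exact Or.inr (tw18_off_flat_bad1_216 f g hf hg u'' hu'' V₀ xZ h0 hadd hcardV9 hS hoff_le p hp hpodd)
  · /- no point with `e/2` odd: `4 ∣ e` off `Z`; round 2 -/
    push Not at hBad
    have hdiv4 : ∀ y, y ∉ Z → (4 : ℤ) ∣ e y := by
      intro y hy
      have hev : Even (e y / 2) := Int.not_odd_iff_even.1 (hBad y hy)
      obtain ⟨k, hk⟩ := hev
      exact ⟨k, by rw [hp2 y hy, hk]; ring⟩
    have hp4 : ∀ y, y ∉ Z → e y = 4 * (e y / 4) := fun y hy => (Int.mul_ediv_cancel' (hdiv4 y hy)).symm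
    have hdich4 : ∀ p, p ∉ Z → (∀ x ∈ V₀.image (bxor p), Even (e x / 4)) ∨
        8 ≤ #((V₀.image (bxor p)).filter fun x => Odd (e x / 4)) :=
      fun p hp => hdich4q p hp fun x hx => hdiv4 x (hcos_out p hp x hx)
    by_cases hBad4 : ∃ p, p ∉ Z ∧ Odd (e p / 4)
    · obtain ⟨p, hp, hpodd⟩ := hBad4
      set B4 := (V₀.image (bxor p)).filter (fun x => Odd (e x / 4)) with hB4
      have hB4ge : 8 ≤ #B4 := (hdich4 p hp).resolve_left fun h =>
        (Int.not_even_iff_odd.2 hpodd) (h p (mem_image.2 ⟨zeroVec, h0, bxor_zeroVec p⟩))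
      have hB4sub : B4 ⊆ univ.filter (fun x => x ∉ Z) := fun x hx =>
        mem_filter.2 ⟨mem_univ _, hcos_out p hp x (mem_filter.1 hx).1⟩
      have hB4sum : (128 : ℤ) ≤ ∑ x ∈ B4, e x ^ 2 := by
        have h1 : ∑ x ∈ B4, (16 : ℤ) ≤ ∑ x ∈ B4, e x ^ 2 := sum_le_sum fun x hx =>
          hcost16 x (hcos_out p hp x (mem_filter.1 hx).1) (hdiv4 x (hcos_out p hp x (mem_filter.1 hx).1)) (mem_filter.1 hx).2
        rw [sum_const, nsmul_eq_mul] at h1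
        have h8 : (8 : ℤ) ≤ #B4 := by exact_mod_cast hB4ge
        linarith
      have hB4le : ∑ x ∈ B4, e x ^ 2 ≤ ∑ x ∈ univ.filter (fun x => x ∉ Z), e x ^ 2 :=
        sum_le_sum_of_subset_of_nonneg hB4sub fun x _ _ => sq_nonneg _
      -- off the bad coset `8 ∣ e`: `e/4` odd elsewhere would make a second coset carry `≥ 8` such points, `128 + 128 > E`
      have h8 : ∀ y, y ∉ Z → y ∉ V₀.image (bxor p) → (8 : ℤ) ∣ e y := by
        intro y hy hyp
        by_contra hn8
        have hyodd : Odd (e y / 4) := by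
          by_contra hev
          obtain ⟨k, hk⟩ := Int.not_odd_iff_even.1 hev
          exact hn8 ⟨k, by rw [hp4 y hy, hk]; ring⟩
        set Cy := (V₀.image (bxor y)).filter (fun x => Odd (e x / 4)) with hCy
        have hC8 : 8 ≤ #Cy := (hdich4 y hy).resolve_left fun h =>
          (Int.not_even_iff_odd.2 hyodd) (h y (mem_image.2 ⟨zeroVec, h0, bxor_zeroVec y⟩))
        have hdisjC : Disjoint B4 Cy := by
          rw [disjoint_left]
          intro x hxp hxy
          exact hyp (hchain p x y (mem_filter.1 hxp).1 (hsymm y x (mem_filter.1 hxy).1))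
        have hsubC : B4 ∪ Cy ⊆ univ.filter (fun x => x ∉ Z) := by
          intro x hx
          rcases mem_union.1 hx with h | h
          · exact hB4sub h
          · exact mem_filter.2 ⟨mem_univ _, hcos_out y hy x (mem_filter.1 h).1⟩
        have h1 : ∑ x ∈ Cy, (16 : ℤ) ≤ ∑ x ∈ Cy, e x ^ 2 := sum_le_sum fun x hx =>
          hcost16 x (hcos_out y hy x (mem_filter.1 hx).1) (hdiv4 x (hcos_out y hy x (mem_filter.1 hx).1)) (mem_filter.1 hx).2
        rw [sum_const, nsmul_eq_mul] at h1
        have h8C : (8 : ℤ) ≤ #Cy := by exact_mod_cast hC8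
        have h2 := sum_le_sum_of_subset_of_nonneg hsubC (f := fun x => e x ^ 2) fun x _ _ => sq_nonneg _
        rw [sum_union hdisjC] at h2
        linarith
      -- a second, empty coset off `Z` and off `p ⊕ V₀`
      obtain ⟨d, -, hd⟩ := fl1_avoid univ V₀ [xZ, p] (by
        rw [hcardV9, card_univ, Fintype.card_fun, Fintype.card_bool, Fintype.card_fin]; norm_num)
      have hdZ : d ∉ Z := by
        intro h
        rw [hS] at h
        obtain ⟨v, hv, hvd⟩ := mem_image.1 h
        exact hd xZ (by simp) (by rw [← hvd, bxor_bxor_cancel_left]; exact hv)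
      have hdC : d ∉ V₀.image (bxor p) := by
        intro h
        obtain ⟨v, hv, hvd⟩ := mem_image.1 h
        exact hd p (by simp) (by rw [← hvd, bxor_bxor_cancel_left]; exact hv)
      right; left
      refine ⟨p, d, hp, hdZ, hdC, fun y hy hyp _ => h8 y hy hyp, ?_, ?_, le_trans hB4sum hB4le⟩
      · have hsub : ((V₀.image (bxor p)).filter fun y => ¬ (8 : ℤ) ∣ e y) ⊆ B4 := by
          intro y hy
          have hy1 := (mem_filter.1 hy).1
          have hy2 := (mem_filter.1 hy).2
          refine mem_filter.2 ⟨hy1, ?_⟩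
          by_contra hev
          obtain ⟨k, hk⟩ := Int.not_odd_iff_even.1 hev
          exact hy2 ⟨k, by rw [hp4 y (hcos_out p hp y hy1), hk]; ring⟩
        have h1 := card_le_card hsub
        have h2 : (#B4 : ℤ) * 16 ≤ 216 := by
          have h := sum_le_sum fun x (hx : x ∈ B4) =>
            hcost16 x (hcos_out p hp x (mem_filter.1 hx).1) (hdiv4 x (hcos_out p hp x (mem_filter.1 hx).1)) (mem_filter.1 hx).2
          rw [sum_const, nsmul_eq_mul] at h
          linarith
        have : #B4 ≤ 13 := by
          have : (#B4 : ℤ) ≤ 13 := by linarith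
          exact_mod_cast this
        omega
      · have hsub : ((V₀.image (bxor d)).filter fun y => ¬ (8 : ℤ) ∣ e y) = ∅ := by
          refine filter_eq_empty_iff.2 fun y hy hn => hn ?_
          have hyZ : y ∉ Z := hcos_out d hdZ y hy
          have hyp : y ∉ V₀.image (bxor p) := fun h => hdC (hchain p y d h (hsymm d y hy))
          exact h8 y hyZ hyp
        rw [hsub, card_empty]; norm_num
    · push Not at hBad4
      left
      intro y hy
      have hev : Even (e y / 4) := Int.not_odd_iff_even.1 (hBad4 y hy)
      obtain ⟨k, hk⟩ := hev
      exact ⟨k, by rw [hp4 y hy, hk]; ring⟩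

end Summit.QuantumAdvantage.QuantumAdvantage.Theorems.CubicForrelation.NearExactIsExact

end
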